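import Summits.ABC.IUTFork.Thm311RealInd1StripPacketStrictnessDyadic
import Summits.ABC.IUTFork.Thm311RealInd1StripHullDyadic
import Summits.ABC.IUTFork.Thm311RealInd1StripPacketDualBoxVolumeUnion
import HarnessLib

/-!
# [IUTchIII] Thm 3.11 (i) (Ind1)+(Ind2) ⟶ Cor 3.12 at the prime `2`, READING (U) (the cell's reading of record), over an all-`ℚ₂(√−1)` place section:
# `ln ν̄_{𝕃_2}` of the hull of the `H`-orbit of the (Ind1)-SLOT-UNION region is STRICTLY below the Dupuy–Hilado number `−|log(Θ)|_2` for EVERY Θ-idele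
# and EVERY factorwise-strip `H ≤ indTwo` (UNCONDITIONAL; no room condition, no Jannsen–Wingberg / Diekert–Nishio binder)

PROOF-ONLY file (abc-iut cell, Cor. 3.12 sub-crew, seat abc-iut-c312-1 = holder of record of the typed [IUTchIII] Thm. 3.11, gen 27; row
«C:P2-PRIME-DICHOTOMY ⟹ STRICTNESS», optional file 4 = the reading-(U) twin of file 3 `Thm311RealInd1StripPrimeStrictnessDyadic`, over file 2
`Thm311RealInd1StripPacketStrictnessDyadic` (trace ceiling of a factorwise-strip `H`, `p`-generic), gen 24's `Thm311RealInd1StripHullDyadic` §5 and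
`Thm311RealInd1StripPacketHullDyadic` §1, gen 21's `Thm311RealInd1StripPacketDualBoxVolumeUnion` (the (U) template: abc-iut-c312-d1's slot-union shape,
`lnνLp_le_sub_of_succ`) and abc-iut-s2's union-content bookkeeping `GenuineLogThetaExactVolume` / `GenuineLogThetaUnionSubIndeterminacy`).
TAKES NO SIDE on [IUTchIII] Cor. 3.12.  No definition, no `Prop` fact, no instance, no notation.

SETTING.  As in file 3: the real prime packet over the GENUINE completions of a place section `σ` (any shell `c`), `K ∋ s` with `s² = −1`, every place of
the section over `2` of local degree `2` (`K_{v̲} ≅ ℚ₂(√−1)`), ANY `2`-local Θ-idele `t`, a family `H_{j,v⃗} ≤ indTwo` acting on pure tensors factorwise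
through the additive closures of the realised (Ind1) strip groups.  Reading (U) at a collection `v⃗ = e` of degree `j = i+1` is the hull of the `H`-orbit
of the (Ind1)-slot-union `M_U = ⋃_σ σ·O_𝕃(−P_Θ)_{v⃗∘σ} = ⋃_a ι_a(t_{i,v_a})·(R_I)^∼` (abc-iut-s2 `realPrimePacketWith_indOneUnion_pilotRegion_eq_slotUnion`), read
against `−|log(Θ)|_2 = ln ν̄_{𝕃_2}(hull of ALL possible images)`, whose summand at `v⃗` is `packetHull(2^{m_U}·log₂(R_I^×))`, `m_U` = the content of `M_U`
(`realPrimePacketWith_exists_content_logμ_possibleImagesHull`).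
* §1 (genuine all-`ℚ₂(√−1)` packet, two factors `b₀ ≠ b₁`) **`packetLogμ_packetHull_orbitH_iUnion_le_container_sub_of_dyadicSqrtNegOne`** — for ANY
  finite family of slot twists `g_a ≠ 0` with `⋃_a ι_a(g_a)·(R_I)^∼ ⊆ 2^m·log₂(R_I^×)`: the hull of the `H`-orbit of the union is admissible and
  `log μ̄ ≤ log μ̄(packetHull(2^m·log₂(R_I^×))) − (Σ_j f(L_j)/D)·log 2` — EVERY piece `ι_a(g_a)·(R_I)^∼` is a principal region inside the same container, hence
  ALWAYS DEEP (file 1 `norm_dEquiv_le_of_mem_smul_normalizedPacket_of_subset`), and the orbit stays in the trace ceiling (file 2); hence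
  `packetHull_orbitH_iUnion_ne_container_of_dyadicSqrtNegOne`;
* §2 (place section) **`localFields_lnνLp_hull_orbitH_indOneUnion_le_negLogThetaAt_sub_of_dyadicSqrtNegOne`** (`≤ −|log(Θ)|_2 −
  (1/ℓ⋆)·((Σ_j f_j/D)·log 2)·Π_b Pr(v_{1,b})` at any chosen collection), **`…_lt_negLogThetaAt_of_dyadicSqrtNegOne`** and **`…_ne_negLogThetaAt_of_dyadicSqrtNegOne`**
  (`ℓ⋆ ≥ 1`): `ln ν̄_{𝕃_2}(reading (U) over H) < −|log(Θ)|_2` for EVERY `t` — R30 §3's «⟹» branch at `p = 2` with NO room-at-a-minimising-slot hypothesis.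
READING (numbers about OUR typed objects; neutral): in the cell's reading of record (U) as well, over a field `K ∋ √−1` and a section all of whose places
over `2` have local degree `2`, the `p = 2` summand of the Θ-side of [IUTchIII] Cor. 3.12 computed over print's (Ind1)⊔(Ind2) AS TYPED (factorwise
strips inside the container) is STRICTLY below Dupuy–Hilado's `−|log(Θ)|_2` for every Θ-idele; the (U)-identity route at `2` is CLOSED AS TYPED there exactly
as the (P) one (file 3).  HONEST SCOPE: OUR typings (THE equivariant lift, THE logarithm, factorwise action; F-B28-1 untouched); factorwise strips bounded
by the trace ceiling — nothing about non-factorwise or further indeterminacies ((Ind3), actions beyond `indTwo`); all places of the section over `2` of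
type `ℚ₂(√−1)` (dyadic local degree `≥ 4`, mixed dyadic packets, odd-wild, even degree ISOLATED); equal-AS-TYPED ≠ equal in print; calibrates
`stub_cor312PerImage` / the (U) junction at the `p = 2` residual, discharges nothing; nothing here asserts that abc is proved or refuted; no side taken
on [IUTchIII] Cor. 3.12 / [IUTchIV] Thm. 1.10, on (U) vs (P), or on any author. [claim: Mochizuki2012, status: disputed]; [cite: Mochizuki2012, IUTchI
Def. 3.1 (a)(e) pp. 61–62; IUTchIII Thm. 3.11 (i) (Ind1)(Ind2) p. 154; Rmk. 3.9.5 (i) p. 127; Cor. 3.12 p. 174, proof Step (xi) p. 183; IUTchIV Prop. 1.1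
p. 9, Prop. 1.4 (i)(iii) p. 13]; [cite: HoshiNishio2022OuterAutMLF, Lemma 2.3 (ii) p. 7]; [cite: DupuyHilado2025, Def. 3.6.3, §3.9, §4.7, §4.9, §4.11, §4.12];
[cite: NeukirchANT1999, Ch. II Prop. (5.7), (6.8)]. typed ≠ proved; located ≠ adjudicated.
-/

set_option autoImplicit false

noncomputable section

open Metric Set Function Module Bornology
open scoped Pointwise TensorProduct

namespace Summit.ABC.IUTFork.Thm311.Real

open NumberField IsDedekindDomain Literature.NumberTheory.NumberFields Literature.IUT.LogVolume
open Literature.NumberTheory.GaloisRepresentations Literature.NumberTheory.GaloisRepresentations.Ultrametric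
open Literature.AnabelianGeometry.AbsoluteAnabelian Literature.IUT.HodgeArakelov
open Literature.IUT.HodgeArakelov.AbsTopMonoids Literature.IUT.LogThetaLattice
open Literature.IUT.LogVolume.TraceZeroDyadicSqrtNegOne

/-! ## §1 Genuine all-`ℚ₂(√−1)` packets: the `H`-orbit hull of a UNION of principal regions — log-volume gap (UNCONDITIONAL) -/

section Dyadic

variable {K : Type} [Field K] [NumberField K]
variable {I : Type} [Fintype I] [DecidableEq I] (w : I → HeightOneSpectrum (𝓞 K)) (hw : ∀ b, ((2 : ℕ) : 𝓞 K) ∈ (w b).asIdeal)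
variable {ι : Π b, RescaledCompletion K 2 (w b) (hw b)} (hι : ∀ b, ι b ^ 2 = -1)
  (he : ∀ b, absRamificationIdx 2 (RescaledCompletion K 2 (w b) (hw b)) = 2)
  (hf : ∀ b, residueDegree 2 (RescaledCompletion K 2 (w b) (hw b)) = 1)
  {ϖ : Π b, (RescaledCompletion K 2 (w b) (hw b))ˣ} (hϖ : ∀ b, IsUniformizer (ϖ b))

include hι he hf hϖ

/-- **THE LOG-VOLUME GAP FOR A SLOT UNION (UNCONDITIONAL, NO ROOM CONDITION).**  Genuine all-`ℚ₂(√−1)` packet with two factors `b₀ ≠ b₁`; `H ≤ indTwo`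
acting factorwise through the realised strip groups; slot twists `g_a ∈ K_{w_a}^×` (`a ∈ I`) and ANY `m` with `⋃_a ι_a(g_a)·(R_I)^∼ ⊆ 2^m·log₂(R_I^×)` (e.g.
the content of the slot union).  Then the `(R_I)^∼`-hull of the `H`-orbit of the union is admissible and
`log μ̄(packetHull(⋃_{γ∈H} γ(⋃_a ι_a(g_a)·(R_I)^∼))) ≤ log μ̄(packetHull(2^m·log₂(R_I^×))) − (Σ_j f(L_j)/D)·log 2` — every piece is ALWAYS DEEP in the common
container (file 1), the orbit lies in the trace ceiling (file 2), gen 21's polydisc volume gap. [claim: Mochizuki2012, status: disputed]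
[cite: Mochizuki2012, IUTchIII Thm. 3.11 (i) p. 154; Cor. 3.12 p. 174, Step (xi) p. 183; IUTchIV Prop. 1.4 (iii) p. 13] [cite: DupuyHilado2025, §3.7,
§4.7, §4.9, §4.11, §4.12] [cite: NeukirchANT1999, Ch. II Prop. (5.5), (5.7)] -/
theorem packetLogμ_packetHull_orbitH_iUnion_le_container_sub_of_dyadicSqrtNegOne {b₀ b₁ : I} (hb : b₀ ≠ b₁)
    (g : ∀ a : I, (RescaledCompletion K 2 (w a) (hw a))ˣ) {m : ℤ}
    (hm : (⋃ a : I, iota 2 (fun b => RescaledCompletion K 2 (w b) (hw b)) a (g a : RescaledCompletion K 2 (w a) (hw a)) •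
        (normalizedPacket 2 (fun b => RescaledCompletion K 2 (w b) (hw b)) :
          Set (PacketAlgebra 2 (fun b => RescaledCompletion K 2 (w b) (hw b))))) ⊆
      (((2 : ℕ) : ℚ_[2]) ^ m) • (logPacket 2 (fun b => RescaledCompletion K 2 (w b) (hw b)) :
        Set (PacketAlgebra 2 (fun b => RescaledCompletion K 2 (w b) (hw b)))))
    (H : Subgroup (PacketAlgebra 2 (fun b => RescaledCompletion K 2 (w b) (hw b)) ≃ₗ[ℚ_[2]]
      PacketAlgebra 2 (fun b => RescaledCompletion K 2 (w b) (hw b))))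
    (hH : H ≤ indTwo 2 (fun b => RescaledCompletion K 2 (w b) (hw b)))
    (hHfac : ∀ γ ∈ H, ∃ δ : Π b, AddAut ((w b).adicCompletion K),
      (∀ b, δ b ∈ AddSubgroup.closure (G := AddAut ((w b).adicCompletion K)) (ind1StripOf (w b) (galoisLog (w b)))) ∧
      ∀ z : Π b, RescaledCompletion K 2 (w b) (hw b),
        γ (PiTensorProduct.tprod ℚ_[2] z) =
          PiTensorProduct.tprod ℚ_[2] (fun b => RescaledCompletion.of K 2 (w b) (hw b)
            (δ b ((RescaledCompletion.of K 2 (w b) (hw b)).symm (z b))))) :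
    PacketAdm 2 (fun b => RescaledCompletion K 2 (w b) (hw b))
        (packetHull 2 (fun b => RescaledCompletion K 2 (w b) (hw b))
          (⋃ γ : H, (γ : PacketAlgebra 2 (fun b => RescaledCompletion K 2 (w b) (hw b)) ≃ₗ[ℚ_[2]]
              PacketAlgebra 2 (fun b => RescaledCompletion K 2 (w b) (hw b))) ''
            ⋃ a : I, iota 2 (fun b => RescaledCompletion K 2 (w b) (hw b)) a (g a : RescaledCompletion K 2 (w a) (hw a)) •
              (normalizedPacket 2 (fun b => RescaledCompletion K 2 (w b) (hw b)) :
                Set (PacketAlgebra 2 (fun b => RescaledCompletion K 2 (w b) (hw b)))))) ∧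
      packetLogμ 2 (fun b => RescaledCompletion K 2 (w b) (hw b))
          (packetHull 2 (fun b => RescaledCompletion K 2 (w b) (hw b))
            (⋃ γ : H, (γ : PacketAlgebra 2 (fun b => RescaledCompletion K 2 (w b) (hw b)) ≃ₗ[ℚ_[2]]
                PacketAlgebra 2 (fun b => RescaledCompletion K 2 (w b) (hw b))) ''
              ⋃ a : I, iota 2 (fun b => RescaledCompletion K 2 (w b) (hw b)) a (g a : RescaledCompletion K 2 (w a) (hw a)) •
                (normalizedPacket 2 (fun b => RescaledCompletion K 2 (w b) (hw b)) :
                  Set (PacketAlgebra 2 (fun b => RescaledCompletion K 2 (w b) (hw b)))))) ≤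
        packetLogμ 2 (fun b => RescaledCompletion K 2 (w b) (hw b))
            (packetHull 2 (fun b => RescaledCompletion K 2 (w b) (hw b))
              ((((2 : ℕ) : ℚ_[2]) ^ m) • (logPacket 2 (fun b => RescaledCompletion K 2 (w b) (hw b)) :
                Set (PacketAlgebra 2 (fun b => RescaledCompletion K 2 (w b) (hw b)))))) -
          (∑ j, (residueDegree 2 (DFac 2 (fun b => RescaledCompletion K 2 (w b) (hw b)) j) : ℝ)) /
              packetDegree 2 (DFac 2 (fun b => RescaledCompletion K 2 (w b) (hw b))) * Real.log 2 := by
  set k := fun b => RescaledCompletion K 2 (w b) (hw b) with hk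
  haveI : Nonempty I := ⟨b₀⟩
  set c : ℚ_[2] := ((2 : ℕ) : ℚ_[2]) ^ m with hc
  set M : Set (PacketAlgebra 2 k) := ⋃ a : I, iota 2 k a (g a : k a) • (normalizedPacket 2 k : Set (PacketAlgebra 2 k)) with hM
  set U : Set (PacketAlgebra 2 k) := ⋃ γ : H, (γ : PacketAlgebra 2 k ≃ₗ[ℚ_[2]] PacketAlgebra 2 k) '' M with hU
  set R' : ℝ := ‖c‖ * ‖(ϖ b₀ : k b₀)‖ ^ (3 * Fintype.card I + 1) with hR'
  -- every piece is a principal region inside the same container: ALWAYS DEEP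
  have hpiece : ∀ a : I, iota 2 k a (g a : k a) • (normalizedPacket 2 k : Set (PacketAlgebra 2 k)) ⊆
      c • (logPacket 2 k : Set (PacketAlgebra 2 k)) := fun a =>
    (Set.subset_iUnion (fun a' : I => iota 2 k a' (g a' : k a') • (normalizedPacket 2 k : Set (PacketAlgebra 2 k))) a).trans hm
  have hdeep : ∀ x ∈ M, ∀ j, ‖dEquiv 2 k x j‖ ≤ R' := by
    intro x hx j
    obtain ⟨a, hxa⟩ := Set.mem_iUnion.mp hx
    exact norm_dEquiv_le_of_mem_smul_normalizedPacket_of_subset k hι he hf hϖ hb c (hpiece a) hxa j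
  -- the orbit is confined to the sub-polydisc `R'`
  have hUS := iUnion_image_subset_add_inter_ker_of_factorwise_strip 2 w hw H hH hHfac c hm
  have hUR : U ⊆ dEquiv 2 k ⁻¹' polydisc (DFac 2 k) (fun _ => R') := by
    intro u hu
    obtain ⟨x, hx, a, ha, rfl⟩ := hUS hu
    refine (mem_polydisc (DFac 2 k)).mpr fun j => ?_
    change ‖dEquiv 2 k (x + a) j‖ ≤ R'
    rw [map_add, Pi.add_apply]
    exact (IsUltrametricDist.norm_add_le_max _ _).trans (max_le (hdeep x hx j)
      (PacketHull.norm_psi_le_of_mem_smul_logPacket_inter_ker k (DFac 2 k) (dEquiv 2 k) hι he hf hϖ b₀ c ha j))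
  -- the container's top: `‖c‖·Π_b ‖ϖ_b³‖ = ‖c‖·ρ^{3n} > R'`
  have hcΛ : ∀ b, ((ϖ b : k b)) ^ 3 ∈ logUnits (k b) := fun b => by
    rw [DyadicNoFixedBall.logUnits_eq_closedBall_cube_of_sq_eq_neg_one (hϖ b) (hι b) (he b) (hf b), mem_closedBall_zero_iff, norm_pow]
  have hdom : ∀ b, ∀ z ∈ logUnits (k b), ‖z‖ ≤ ‖((ϖ b : k b)) ^ 3‖ := fun b z hz => by
    have h := (isGreatest_norm_logUnits (hϖ b) (hι b) (he b) (hf b)).2 ⟨z, hz, rfl⟩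
    rw [norm_pow, ← zpow_natCast, Nat.cast_ofNat]; exact h
  have hprod : ∏ b, ‖((ϖ b : k b)) ^ 3‖ = ‖(ϖ b₀ : k b₀)‖ ^ (3 * Fintype.card I) := by
    rw [Finset.prod_congr rfl fun b _ => by rw [norm_pow, norm_uniformizer_eq k he hϖ b b₀], Finset.prod_const, Finset.card_univ,
      ← pow_mul, mul_comm]
  have hR'lt : R' < ‖(((2 : ℕ) : ℚ_[2]) ^ m)‖ * ∏ b, ‖((ϖ b : k b)) ^ 3‖ := by
    rw [hprod, hR', hc]
    exact PacketHull.norm_mul_pow_succ_lt k hϖ b₀ (zpow_ne_zero m (by norm_num))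
  have hA : PacketAdm 2 k (iota 2 k b₀ (g b₀ : k b₀) • (normalizedPacket 2 k : Set (PacketAlgebra 2 k))) :=
    packetAdm_iota_smul 2 k b₀ (g b₀).ne_zero (packetAdm_normalizedPacket 2 k)
  have hAU : iota 2 k b₀ (g b₀ : k b₀) • (normalizedPacket 2 k : Set (PacketAlgebra 2 k)) ⊆ U :=
    (Set.subset_iUnion (fun a' : I => iota 2 k a' (g a' : k a') • (normalizedPacket 2 k : Set (PacketAlgebra 2 k))) b₀).trans
      (subset_iUnion_image_orbitH 2 w hw H M)
  exact packetLogμ_packetHull_le_container_sub_of_subset_preimage_polydisc_of_lt 2 k m hcΛ hdom hR'lt hA hAU hUR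

/-- **… hence the `H`-orbit hull of the slot union is NOT the container's hull** (two factors `b₀ ≠ b₁`): a log-volume gap of a positive margin
separates them. [claim: Mochizuki2012, status: disputed] [cite: Mochizuki2012, IUTchIII Rmk. 3.9.5 (i) p. 127; Cor. 3.12 Step (xi) p. 183]
[cite: DupuyHilado2025, §4.9, §4.12] -/
theorem packetHull_orbitH_iUnion_ne_container_of_dyadicSqrtNegOne {b₀ b₁ : I} (hb : b₀ ≠ b₁)
    (g : ∀ a : I, (RescaledCompletion K 2 (w a) (hw a))ˣ) {m : ℤ}
    (hm : (⋃ a : I, iota 2 (fun b => RescaledCompletion K 2 (w b) (hw b)) a (g a : RescaledCompletion K 2 (w a) (hw a)) •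
        (normalizedPacket 2 (fun b => RescaledCompletion K 2 (w b) (hw b)) :
          Set (PacketAlgebra 2 (fun b => RescaledCompletion K 2 (w b) (hw b))))) ⊆
      (((2 : ℕ) : ℚ_[2]) ^ m) • (logPacket 2 (fun b => RescaledCompletion K 2 (w b) (hw b)) :
        Set (PacketAlgebra 2 (fun b => RescaledCompletion K 2 (w b) (hw b)))))
    (H : Subgroup (PacketAlgebra 2 (fun b => RescaledCompletion K 2 (w b) (hw b)) ≃ₗ[ℚ_[2]]
      PacketAlgebra 2 (fun b => RescaledCompletion K 2 (w b) (hw b))))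
    (hH : H ≤ indTwo 2 (fun b => RescaledCompletion K 2 (w b) (hw b)))
    (hHfac : ∀ γ ∈ H, ∃ δ : Π b, AddAut ((w b).adicCompletion K),
      (∀ b, δ b ∈ AddSubgroup.closure (G := AddAut ((w b).adicCompletion K)) (ind1StripOf (w b) (galoisLog (w b)))) ∧
      ∀ z : Π b, RescaledCompletion K 2 (w b) (hw b),
        γ (PiTensorProduct.tprod ℚ_[2] z) =
          PiTensorProduct.tprod ℚ_[2] (fun b => RescaledCompletion.of K 2 (w b) (hw b)
            (δ b ((RescaledCompletion.of K 2 (w b) (hw b)).symm (z b))))) :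
    packetHull 2 (fun b => RescaledCompletion K 2 (w b) (hw b))
        (⋃ γ : H, (γ : PacketAlgebra 2 (fun b => RescaledCompletion K 2 (w b) (hw b)) ≃ₗ[ℚ_[2]]
            PacketAlgebra 2 (fun b => RescaledCompletion K 2 (w b) (hw b))) ''
          ⋃ a : I, iota 2 (fun b => RescaledCompletion K 2 (w b) (hw b)) a (g a : RescaledCompletion K 2 (w a) (hw a)) •
            (normalizedPacket 2 (fun b => RescaledCompletion K 2 (w b) (hw b)) :
              Set (PacketAlgebra 2 (fun b => RescaledCompletion K 2 (w b) (hw b))))) ≠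
      packetHull 2 (fun b => RescaledCompletion K 2 (w b) (hw b))
        ((((2 : ℕ) : ℚ_[2]) ^ m) • (logPacket 2 (fun b => RescaledCompletion K 2 (w b) (hw b)) :
          Set (PacketAlgebra 2 (fun b => RescaledCompletion K 2 (w b) (hw b))))) := by
  haveI : Nonempty I := ⟨b₀⟩
  intro hEq
  obtain ⟨-, hle⟩ := packetLogμ_packetHull_orbitH_iUnion_le_container_sub_of_dyadicSqrtNegOne w hw hι he hf hϖ hb g hm H hH hHfac
  rw [hEq] at hle
  have hmar := margin_pos 2 (fun b => RescaledCompletion K 2 (w b) (hw b))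
  linarith

end Dyadic

/-! ## §2 The genuine place-section packets at `p = 2`: reading (U) over a factorwise-strip `H` is STRICTLY below `−|log(Θ)|_2` -/

section PlaceSection

variable {F₀ : Type} [Field F₀] [NumberField F₀] {K : Type} [Field K] [NumberField K] [Algebra F₀ K]
variable (σ : PlaceSection F₀ K)
variable (c : (j : ℕ) → (Fin (j + 1) → placesOver F₀ 2) → ℚ_[2]) (hc0 : ∀ j e, c j e ≠ 0)
  (hcσ : ∀ (j : ℕ) (τ : Equiv.Perm (Fin (j + 1))) (e : Fin (j + 1) → placesOver F₀ 2), c j (e ∘ τ) = c j e)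

/-- In a collection of `j + 2` slots the first and the last slot differ. [cite: DupuyHilado2025, Def. 3.6.1] -/
private theorem zero_ne_last' (n : ℕ) : (0 : Fin (n + 1 + 1)) ≠ Fin.last (n + 1) := by
  intro h
  have h' := congrArg Fin.val h
  rw [Fin.val_zero, Fin.val_last] at h'
  omega

/-- **READING (U) AT `p = 2`: STRICTLY BELOW `−|log(Θ)|_2` BY AN EXPLICIT MARGIN (UNCONDITIONAL, NO ROOM CONDITION).**  Real prime packet over the
genuine completions of a place section (any shell `c`), `K ∋ s` with `s² = −1`, every place of the section over `2` of local degree `2`; Θ-idele `t`, family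
`H = (H_{j,v⃗})` of subgroups of the container `indTwo`; if at ONE degree `j₁ = i₁+1 ≤ ℓ⋆` and ONE collection `v⃗₁ = e₁` the group `H_{j₁,v⃗₁}` acts factorwise
through the realised strip groups, then
`ln ν̄_{𝕃_2}(v⃗ ↦ hull(⋃_{g∈H_{v⃗}} g(⋃_σ σ·O_𝕃(−P_Θ)_{v⃗∘σ}))) ≤ −|log(Θ)|_2 − (1/ℓ⋆)·((Σ_j f(L_j)/D)·log 2)·Π_b Pr(v_{1,b})` (§1 at the content of the slot union +
abc-iut-c312-d1's summandwise monotonicity) — R30 §3's strict branch at `p = 2` WITHOUT any room hypothesis. [claim: Mochizuki2012, status: disputed]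
[cite: Mochizuki2012, IUTchI Def. 3.1 (a)(e) pp. 61–62; IUTchIII Thm. 3.11 (i) p. 154; Cor. 3.12 p. 174; IUTchIV Prop. 1.4 (iii) p. 13]
[cite: DupuyHilado2025, Def. 3.6.3, §3.9, §4.7, §4.11, §4.12] [cite: NeukirchANT1999, Ch. II Prop. (5.7), (6.8)] -/
theorem localFields_lnνLp_hull_orbitH_indOneUnion_le_negLogThetaAt_sub_of_dyadicSqrtNegOne {s : K} (hs : s ^ 2 = -1)
    (hd : ∀ w : placesOver F₀ 2, localDeg K (σ.lift w.1) = 2) {lstar : ℕ}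
    (t : Fin lstar → (v : placesOver F₀ 2) → ((σ.localFields 2).k v)ˣ)
    (H : (j : ℕ) → (e : Fin (j + 1) → placesOver F₀ 2) →
      Subgroup (PacketAlgebra 2 (fun b => (σ.localFields 2).k (e b)) ≃ₗ[ℚ_[2]]
        PacketAlgebra 2 (fun b => (σ.localFields 2).k (e b))))
    (hH : ∀ j e, H j e ≤ indTwo 2 (fun b => (σ.localFields 2).k (e b)))
    (i₁ : Fin lstar) (e₁ : Fin ((i₁ : ℕ) + 1 + 1) → placesOver F₀ 2)
    (hHfac : ∀ γ ∈ H ((i₁ : ℕ) + 1) e₁, ∃ δ : Π b, AddAut ((σ.lift (e₁ b).1).adicCompletion K),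
      (∀ b, δ b ∈ AddSubgroup.closure (G := AddAut ((σ.lift (e₁ b).1).adicCompletion K))
        (ind1StripOf (σ.lift (e₁ b).1) (galoisLog (σ.lift (e₁ b).1)))) ∧
      ∀ z : Π b, (σ.localFields 2).k (e₁ b),
        (γ : PacketAlgebra 2 (fun b => (σ.localFields 2).k (e₁ b)) ≃ₗ[ℚ_[2]]
            PacketAlgebra 2 (fun b => (σ.localFields 2).k (e₁ b))) (PiTensorProduct.tprod ℚ_[2] z) =
          PiTensorProduct.tprod ℚ_[2] (fun b => RescaledCompletion.of K 2 (σ.lift (e₁ b).1) (σ.natCast_mem_lift (e₁ b))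
            (δ b ((RescaledCompletion.of K 2 (σ.lift (e₁ b).1) (σ.natCast_mem_lift (e₁ b))).symm (z b))))) :
    (realPrimePacketWith 2 (σ.localFields 2) c hc0 hcσ).lnνLp lstar (fun j e =>
        packetHull 2 (fun b => (σ.localFields 2).k (e b))
          (⋃ g : H j e, (g : PacketAlgebra 2 (fun b => (σ.localFields 2).k (e b)) ≃ₗ[ℚ_[2]]
              PacketAlgebra 2 (fun b => (σ.localFields 2).k (e b))) ''
            ⋃ τ : Equiv.Perm (Fin (j + 1)), (realPrimePacketWith 2 (σ.localFields 2) c hc0 hcσ).perm τ e ''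
              (realPrimePacketWith 2 (σ.localFields 2) c hc0 hcσ).pilotRegion t j (e ∘ τ))) ≤
      (realPrimePacketWith 2 (σ.localFields 2) c hc0 hcσ).negLogThetaAt lstar t -
        (1 / (lstar : ℝ)) *
          (((∑ j, (residueDegree 2 (DFac 2 (fun b => (σ.localFields 2).k (e₁ b)) j) : ℝ)) /
              packetDegree 2 (DFac 2 (fun b => (σ.localFields 2).k (e₁ b))) * Real.log 2) *
            ∏ b, weight F₀ (e₁ b).1) := by
  unfold PrimePacket.negLogThetaAt
  -- the slot-union rewriting of abc-iut-c312-d1's (U)-shape, at every summand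
  have hUe : ∀ (i : Fin lstar) (e : Fin ((i : ℕ) + 1 + 1) → placesOver F₀ 2),
      (⋃ τ : Equiv.Perm (Fin ((i : ℕ) + 1 + 1)),
        ((realPrimePacketWith 2 (σ.localFields 2) c hc0 hcσ).perm τ e ''
          (realPrimePacketWith 2 (σ.localFields 2) c hc0 hcσ).pilotRegion t ((i : ℕ) + 1) (e ∘ τ) :
            Set (PacketAlgebra 2 (fun b => (σ.localFields 2).k (e b))))) =
        ⋃ a : Fin ((i : ℕ) + 1 + 1), iota 2 (fun b => (σ.localFields 2).k (e b)) a (t i (e a) : (σ.localFields 2).k (e a)) •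
          (normalizedPacket 2 (fun b => (σ.localFields 2).k (e b)) : Set (PacketAlgebra 2 (fun b => (σ.localFields 2).k (e b)))) :=
    fun i e => realPrimePacketWith_indOneUnion_pilotRegion_eq_slotUnion 2 (σ.localFields 2) c hc0 hcσ t i e
  refine lnνLp_le_sub_of_succ (realPrimePacketWith 2 (σ.localFields 2) c hc0 hcσ) lstar (fun i e => ?_) i₁ e₁ ?_
  · obtain ⟨m, -, -, -, hadm, -⟩ := realPrimePacketWith_exists_content_logμ_possibleImagesHull 2 (σ.localFields 2) c hc0 hcσ t i e
    show PacketAdm 2 (fun b => (σ.localFields 2).k (e b)) _ ∧ _ ∧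
      packetHull 2 (fun b => (σ.localFields 2).k (e b)) _ ⊆ packetHull 2 (fun b => (σ.localFields 2).k (e b)) _
    rw [hUe i e]
    exact ⟨packetAdm_hull_orbitH_slotUnion 2 (σ.localFields 2) t i e (H _ e) (hH _ e), hadm,
      packetHull_mono 2 _ (realPrimePacketWith_orbitH_slotUnion_subset_possibleImages 2 (σ.localFields 2) c hc0 hcσ t i e (H _ e)
        (hH _ e))⟩
  · -- the special summand: §1 at `v⃗₁`, read against the union content identity for the container's summand
    have hι : ∀ b, (RescaledCompletion.of K 2 (σ.lift (e₁ b).1) (σ.natCast_mem_lift (e₁ b))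
        (algebraMap K ((σ.lift (e₁ b).1).adicCompletion K) s)) ^ 2 = -1 :=
      fun b => sq_of_algebraMap_eq_neg_one' (σ.lift (e₁ b).1) (σ.natCast_mem_lift (e₁ b)) hs
    have hef := fun b => absRamificationIdx_eq_two_and_residueDegree_eq_one_of_localDeg_eq_two (σ.lift (e₁ b).1)
      (σ.natCast_mem_lift (e₁ b)) (hι b) (hd (e₁ b))
    have hϖex := fun b => exists_isUniformizer (F := (σ.localFields 2).k (e₁ b))
    choose ϖ hϖ using hϖex
    show packetLogμ 2 (fun b => (σ.localFields 2).k (e₁ b)) _ ≤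
      packetLogμ 2 (fun b => (σ.localFields 2).k (e₁ b))
        ((realPrimePacketWith 2 (σ.localFields 2) c hc0 hcσ).possibleImagesHull
          ((realPrimePacketWith 2 (σ.localFields 2) c hc0 hcσ).pilotRegion t) ((i₁ : ℕ) + 1) e₁) - _
    obtain ⟨m, hm, -, hhull, -, -⟩ :=
      realPrimePacketWith_exists_content_logμ_possibleImagesHull 2 (σ.localFields 2) c hc0 hcσ t i₁ e₁
    rw [hUe i₁ e₁, hhull]
    exact (packetLogμ_packetHull_orbitH_iUnion_le_container_sub_of_dyadicSqrtNegOne (fun b => σ.lift (e₁ b).1)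
      (fun b => σ.natCast_mem_lift (e₁ b)) hι (fun b => (hef b).1) (fun b => (hef b).2) hϖ (zero_ne_last' i₁)
      (fun a => t i₁ (e₁ a)) hm (H _ e₁) (hH _ e₁) hHfac).2

/-- **Hence STRICTLY below `−|log(Θ)|_2`** (every `Pr(v) > 0`, `ℓ⋆ ≥ 1`, the margin `(Σ_j f_j/D)·log 2 > 0`): under the hypotheses of
`…_le_negLogThetaAt_sub_of_dyadicSqrtNegOne`, `ln ν̄_{𝕃_2}(reading (U) over H) < −|log(Θ)|_2` — for EVERY Θ-idele `t`; with abc-iut-c312-d1's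
`realPrimePacketWith_lnνLp_hull_orbitH_slotUnion_le_negLogThetaAt` (always `≤`), [IUTchIII] Cor. 3.12 in reading (U) over such an `H` is strictly harder than
over the container at `2`. [claim: Mochizuki2012, status: disputed] [cite: Mochizuki2012, IUTchIII Thm. 3.11 (i) p. 154; Cor. 3.12 p. 174]
[cite: DupuyHilado2025, Def. 3.6.3, §4.11, §4.12] -/
theorem localFields_lnνLp_hull_orbitH_indOneUnion_lt_negLogThetaAt_of_dyadicSqrtNegOne {s : K} (hs : s ^ 2 = -1)
    (hd : ∀ w : placesOver F₀ 2, localDeg K (σ.lift w.1) = 2) {lstar : ℕ}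
    (t : Fin lstar → (v : placesOver F₀ 2) → ((σ.localFields 2).k v)ˣ)
    (H : (j : ℕ) → (e : Fin (j + 1) → placesOver F₀ 2) →
      Subgroup (PacketAlgebra 2 (fun b => (σ.localFields 2).k (e b)) ≃ₗ[ℚ_[2]]
        PacketAlgebra 2 (fun b => (σ.localFields 2).k (e b))))
    (hH : ∀ j e, H j e ≤ indTwo 2 (fun b => (σ.localFields 2).k (e b)))
    (i₁ : Fin lstar) (e₁ : Fin ((i₁ : ℕ) + 1 + 1) → placesOver F₀ 2)
    (hHfac : ∀ γ ∈ H ((i₁ : ℕ) + 1) e₁, ∃ δ : Π b, AddAut ((σ.lift (e₁ b).1).adicCompletion K),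
      (∀ b, δ b ∈ AddSubgroup.closure (G := AddAut ((σ.lift (e₁ b).1).adicCompletion K))
        (ind1StripOf (σ.lift (e₁ b).1) (galoisLog (σ.lift (e₁ b).1)))) ∧
      ∀ z : Π b, (σ.localFields 2).k (e₁ b),
        (γ : PacketAlgebra 2 (fun b => (σ.localFields 2).k (e₁ b)) ≃ₗ[ℚ_[2]]
            PacketAlgebra 2 (fun b => (σ.localFields 2).k (e₁ b))) (PiTensorProduct.tprod ℚ_[2] z) =
          PiTensorProduct.tprod ℚ_[2] (fun b => RescaledCompletion.of K 2 (σ.lift (e₁ b).1) (σ.natCast_mem_lift (e₁ b))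
            (δ b ((RescaledCompletion.of K 2 (σ.lift (e₁ b).1) (σ.natCast_mem_lift (e₁ b))).symm (z b))))) :
    (realPrimePacketWith 2 (σ.localFields 2) c hc0 hcσ).lnνLp lstar (fun j e =>
        packetHull 2 (fun b => (σ.localFields 2).k (e b))
          (⋃ g : H j e, (g : PacketAlgebra 2 (fun b => (σ.localFields 2).k (e b)) ≃ₗ[ℚ_[2]]
              PacketAlgebra 2 (fun b => (σ.localFields 2).k (e b))) ''
            ⋃ τ : Equiv.Perm (Fin (j + 1)), (realPrimePacketWith 2 (σ.localFields 2) c hc0 hcσ).perm τ e ''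
              (realPrimePacketWith 2 (σ.localFields 2) c hc0 hcσ).pilotRegion t j (e ∘ τ))) <
      (realPrimePacketWith 2 (σ.localFields 2) c hc0 hcσ).negLogThetaAt lstar t := by
  have hle := localFields_lnνLp_hull_orbitH_indOneUnion_le_negLogThetaAt_sub_of_dyadicSqrtNegOne σ c hc0 hcσ hs hd t H hH i₁ e₁ hHfac
  haveI : Nonempty (Fin ((i₁ : ℕ) + 1 + 1)) := ⟨Fin.last _⟩
  have hmar := margin_pos 2 (fun b => (σ.localFields 2).k (e₁ b))
  have hl : (0 : ℝ) < 1 / (lstar : ℝ) := by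
    have : 0 < lstar := lt_of_le_of_lt (Nat.zero_le _) i₁.2
    positivity
  have hw : 0 < ∏ b, weight F₀ (e₁ b).1 := by
    refine Finset.prod_pos fun b _ => ?_
    unfold weight
    have h1 : (0 : ℝ) < localDegree F₀ (e₁ b).1 := by exact_mod_cast localDegree_pos F₀ (e₁ b).1
    have h2 : (0 : ℝ) < Module.finrank ℚ F₀ := by exact_mod_cast Module.finrank_pos
    exact div_pos h1 h2
  have hpos : 0 < (1 / (lstar : ℝ)) *
      (((∑ j, (residueDegree 2 (DFac 2 (fun b => (σ.localFields 2).k (e₁ b)) j) : ℝ)) /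
          packetDegree 2 (DFac 2 (fun b => (σ.localFields 2).k (e₁ b))) * Real.log 2) *
        ∏ b, weight F₀ (e₁ b).1) := mul_pos hl (mul_pos hmar hw)
  linarith

/-- **THE `p = 2` (U)-SUMMAND IDENTITY NEVER HOLDS AS TYPED** (`ℓ⋆ ≥ 1`; `K ∋ √−1`, every place of the section over `2` of local degree `2`): for EVERY
Θ-idele `t` and EVERY family `H_{j,v⃗} ≤ indTwo` acting factorwise through the realised strip groups at every collection,
`ln ν̄_{𝕃_2}(reading (U) over H) ≠ −|log(Θ)|_2` — the left side of R30 §3's displayed equivalence at `p = 2`, with NO room condition.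
[claim: Mochizuki2012, status: disputed] [cite: Mochizuki2012, IUTchIII Thm. 3.11 (i) p. 154; Cor. 3.12 p. 174] [cite: DupuyHilado2025, Def. 3.6.3, §4.11, §4.12] -/
theorem localFields_lnνLp_hull_orbitH_indOneUnion_ne_negLogThetaAt_of_dyadicSqrtNegOne {s : K} (hs : s ^ 2 = -1)
    (hd : ∀ w : placesOver F₀ 2, localDeg K (σ.lift w.1) = 2) {lstar : ℕ} (hl : 0 < lstar)
    (t : Fin lstar → (v : placesOver F₀ 2) → ((σ.localFields 2).k v)ˣ)
    (H : (j : ℕ) → (e : Fin (j + 1) → placesOver F₀ 2) →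
      Subgroup (PacketAlgebra 2 (fun b => (σ.localFields 2).k (e b)) ≃ₗ[ℚ_[2]]
        PacketAlgebra 2 (fun b => (σ.localFields 2).k (e b))))
    (hH : ∀ j e, H j e ≤ indTwo 2 (fun b => (σ.localFields 2).k (e b)))
    (hHfac : ∀ (i : Fin lstar) (e : Fin ((i : ℕ) + 1 + 1) → placesOver F₀ 2), ∀ γ ∈ H ((i : ℕ) + 1) e,
      ∃ δ : Π b, AddAut ((σ.lift (e b).1).adicCompletion K),
        (∀ b, δ b ∈ AddSubgroup.closure (G := AddAut ((σ.lift (e b).1).adicCompletion K))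
          (ind1StripOf (σ.lift (e b).1) (galoisLog (σ.lift (e b).1)))) ∧
        ∀ z : Π b, (σ.localFields 2).k (e b),
          (γ : PacketAlgebra 2 (fun b => (σ.localFields 2).k (e b)) ≃ₗ[ℚ_[2]]
              PacketAlgebra 2 (fun b => (σ.localFields 2).k (e b))) (PiTensorProduct.tprod ℚ_[2] z) =
            PiTensorProduct.tprod ℚ_[2] (fun b => RescaledCompletion.of K 2 (σ.lift (e b).1) (σ.natCast_mem_lift (e b))
              (δ b ((RescaledCompletion.of K 2 (σ.lift (e b).1) (σ.natCast_mem_lift (e b))).symm (z b))))) :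
    (realPrimePacketWith 2 (σ.localFields 2) c hc0 hcσ).lnνLp lstar (fun j e =>
        packetHull 2 (fun b => (σ.localFields 2).k (e b))
          (⋃ g : H j e, (g : PacketAlgebra 2 (fun b => (σ.localFields 2).k (e b)) ≃ₗ[ℚ_[2]]
              PacketAlgebra 2 (fun b => (σ.localFields 2).k (e b))) ''
            ⋃ τ : Equiv.Perm (Fin (j + 1)), (realPrimePacketWith 2 (σ.localFields 2) c hc0 hcσ).perm τ e ''
              (realPrimePacketWith 2 (σ.localFields 2) c hc0 hcσ).pilotRegion t j (e ∘ τ))) ≠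
      (realPrimePacketWith 2 (σ.localFields 2) c hc0 hcσ).negLogThetaAt lstar t := by
  obtain ⟨w₀⟩ : Nonempty (placesOver F₀ 2) := let ⟨v, hv⟩ := placesOver_nonempty F₀ 2; ⟨⟨v, hv⟩⟩
  exact (localFields_lnνLp_hull_orbitH_indOneUnion_lt_negLogThetaAt_of_dyadicSqrtNegOne σ c hc0 hcσ hs hd t H hH ⟨0, hl⟩ (fun _ => w₀)
    (hHfac ⟨0, hl⟩ (fun _ => w₀))).ne

end PlaceSection

end Summit.ABC.IUTFork.Thm311.Real

end
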